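import Literature.NumberTheory.EllipticCurves.Rank1Residual.PrintShape
import Literature.NumberTheory.EllipticCurves.Rank1Residual.Predicates
import HarnessLib

/-!
# Burungale–Castella–Skinner 2025, Cor. 1.3.1: the `p`-part of the BSD formula in analytic rank `≤ 1` at a good ordinary prime `p > 3` under (irr_ℚ) and (im) — no conductor condition

HONEST FRAMING (cell `b2b-bsdres`, run/shared/lean/b2b/bsd-rank1-residual/): the cell deletes the
COMBINATION-SHAPED residual classes of the BSD formula in analytic rank `≤ 1` from PUBLISHED
theorems only and TYPES the construction-shaped ones; this is not "finishing BSD". This file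
vendors ONE published theorem as a named fact (`def … : Prop`, nothing asserted; D-0014), with its
hypotheses spelled by the cell's predicate file `Rank1Residual/Predicates.lean`
(= `bsdN/HYPOTHESES.md`), and proves its bookkeeping consequence `BSD(E,p)` (Miller) through the
cell's bridge `Rank1Residual/PrintShape.lean`.

Source (read: arXiv:2405.00270v2, pp. 2 and 4, materialised `paper:arxiv-2405.00270` p0002, p0004):
A. Burungale, F. Castella, C. Skinner, *Base change and Iwasawa main conjectures for GL₂*, Int.
Math. Res. Not. IMRN 2025, no. 8, rnaf082, doi:10.1093/imrn/rnaf082 [BurungaleCastellaSkinner2025]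
— PUBLISHED (Crossref 2025; census row `T-BCS`, RESIDUAL-CASES §a.1 C2). Verbatim (p. 4):

> **Corollary 1.3.1.** Let `E/ℚ` be a non-CM elliptic curve. Let `p > 3` be a prime of good
> ordinary reduction such that (irr_ℚ) and (im) hold. If `ord_{s=1} L(E,s) = r ∈ {0,1}`, then
> `|L^{(r)}(E,1)/(Reg(E)·Ω_E)|_p^{-1} = |#Ш(E)·∏_{ℓ∤∞} c_ℓ(E)|_p^{-1}`
> and hence the `p`-part of the […] BSD formula for `E` is true. [one adjective elided]

with (p. 2) "(irr_ℚ): `E[p]` is an irreducible `G_ℚ`-module" and "(im): there exists an element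
`σ ∈ G_{ℚ(μ_{p^∞})}` such that `T/(σ − 1)T ≃ ℤ_p`" (`T` the `p`-adic Tate module). Printed proof
(p. 4): `r = 0` from Thm. 1.1.2 (cyclotomic IMC without (mult)) + interpolation + Greenberg's
control theorem [Gre99, Thm. 4.1]; `r = 1` from Thm. 1.2.4 (anticyclotomic IMC) + BDP `p`-adic
Waldspurger + the anticyclotomic control theorem [JSW17, Thm. 3.3.1] + the `r = 0` case for a
quadratic twist. Rem. 1.3.2: "the above result does not impose any condition on the conductor of `E`."
The related tree fact `burungale_castella_skinner_charIdeal_eq_padicLFunction`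
(`CyclotomicIwasawaMainTheoremIrreducible.lean`) is Thm. 1.1.2 (a) (the IMC in `Λ ⊗ ℚ_p`), not this
corollary.

Transcription (dictionary of bsd.S30 `padicValRat_bsd_rank_zero` and of `Rank1Residual/PrintShape`):
`W` a globally minimal model of `E`; "non-CM" = `¬ W.HasCM`; "`p > 3`" = `3 < p`; good ordinary =
`Rank1Residual.GoodOrd W p` (`p ∤ N`, `p ∤ a_p`); (irr_ℚ) = `Rank1Residual.Irr W p`; (im) =
`Rank1Residual.BigIm W p` (the cell's transcription on the integral Tate module `W.tateModule p`);
`ord_{s=1} L(E,s) = r ∈ {0,1}` = `W.analyticRank ≤ 1` with `L^{(r)}(E,1) = r! · W.leadingLCoeff`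
(`r! = 1`); `Reg(E) = W.regulator` (Gram determinant of Néron–Tate; any power of `2` in the height
normalisation is invisible at `p > 3`), `Ω_E = W.realPeriodRat` (Néron period with components,
p. 4 has no separate `c_∞`), `#Ш(E) = W.shaOrder` under the binder `Finite W.sha` (a theorem for
`r ≤ 1`, bsd.S17, carried as a binder exactly as in bsd.S30 and in the sibling JSW/Castella facts),
`∏_{ℓ∤∞} c_ℓ = W.tamagawaProduct`; rationality of the quotient is part of the transcription
(`∃ q : ℚ`). The conclusion is literally the hypothesis `h` of `Rank1Residual.bsdp_of_padicVal_printShape`.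
No `_holds` is to be expected soon (Eisenstein congruences on unitary groups, Hida theory over CM
fields, Beilinson–Flach classes: none in Mathlib); consumers take `(h : cor131_padicValRat_bsd_rank_le_one)`.

## D-audit provenance and reading flags of record

Row D1 of the rank-`≤ 1` partition; recorded 2026-08-27 by the typer seat of cell `bsd-litref/bcs25`
(sheets under `pub/bsd-litref/bcs25/sheets/`, cited by sha16). NOTHING below changes the statement
or its consumers.

* PRINT SIDE (statement-as-typed vs print). Binder-by-binder audit
  `pub/bsd-ssimc/audit1-DAUDIT-1.md` (sha16 28437c62ce707d3c) §A.1 — rows a–g, i VERBATIM against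
  arXiv:2405.00270v2 p. 4 L3–31 / p. 2 L4, L22; row h (`Finite W.sha`) weaker than print (discharged
  by `hGZK` in every consumer) — referee C ROUND 258 PASS-as-filed; re-read independently by three
  seats of cell `bsd-litref/bcs25` with the same verdict VERBATIM, 0 rows stronger than print, NO
  binder fix: typer `bcs25-ty-BINDERS-v1.md` (f71e665b2c3678c6) §1 with by-name kernel evidence
  `d_audit_bcs25_ty_byname_check.lean` (f50a62c140229a42) + `_add1` (cd094e079d439710); reader 1
  `D-AUDIT-bcs25-r1.md` (c5b8643a52e7214b) §A + ADDENDUM-1 (dbc9aa2f3ef990bc), -2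
  (fc58c16be85a8fa1), -3 (1d48843188dce73e), -4 (902c97eadf348717); reader 2 `D-AUDIT-bcs25-r2.md`
  (fac923bfae9a5984) §1 + add1 (a40dc663583b926e), add2 (fca86de9aa1682df), add3 (5bbfa4a4e0d35746),
  add4 (917141bc5e478c41) — the ten reader files graded in one slot by reading desk C4
  (`pub-bsdpct-r7`), ROUND C4-R4 (2026-08-27T01:26:08Z): «statement VERBATIM ×2 CONCUR — OF RECORD»
  (rows a–g, i = print; row h weaker-than-print in the honest direction, discharged by every
  consumer via `hGZK`; the three typer kernel companions re-run rc 0 at the desk); NO binder fix;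
  Obs-D1-1 ENDORSED as CLOSED on D1. Obs-D1-1 of audit-1 (the printed `r = 1` proof sketch cites
  Thm. 1.2.4 (b), stated under (sur), while the corollary asks (im)) has no live instance: `p ≥ 5 ∧`
  (irr_ℚ) `⇒` ((im) ⟺ (sur)), tree theorem
  `Summit.BirchSwinnertonDyer.Rank1Residual.X9.bigIm_iff_surj_of_irr`. The IMRN typeset numbering is
  cite-only (acq-06158); every locator is arXiv v2's.
* PROOF-INPUT SIDE (why the census books the cells this fact alone covers LITERAL; referee C R258.4
  (ii) / R262.1 / R274.2, director ruling
  `pub-bsdpct-r3/CONSUMED-WAKE-RULING-DIRECTOR-TIER-i-ii-c27190b14c830f86.md`): composite reading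
  flag `BCS25-IMC-equiv@BSTW+Wan15-Thm3@Fuj06(unpublished)+Hid04-gap`, three components, each
  located and CONFIRMED by both reader sheets (reading desk C4 ROUND C4-R4: (1) «PASS-in-cell ×2
  CONCUR — VERDICT OF RECORD, node stays PRE ⇒ RE-WORD» `BCS25-IMC-equiv@BSTW(II.1.18-ord
  PASS-in-cell; PartI-PRE+(X))`; (2) «GAP(line) CONFIRMED ×2 — VERDICT OF RECORD»; (3) «CONFIRMED
  ×2», RE-WORD `Hid04-density@Hi4(to-appear)` ENDORSED; «0 cells move»; a D1 booking tranche is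
  TRIPLE-conditional — (1) Part I refereed, (2c) covered, (3) repaired in refereed print) —
  (N5) Thm. 4.1.3 ⇐ [BSTW23, §9.3.2] = BSTW II Prop. 1.18 ordinary, `· = ∅` (arXiv:2409.01350,
  PREPRINT; BCS p. 8 L27–51, used only in the rational (i)⇒(ii) and integral (ii)⇒(i) directions, p.
  10 L40–55): re-proved in cell bsd-ssimc (Theorem A, REPORT-bstw-2 PASS; kernel lemmas
  `IwasawaDivisibilityTransfer.lean`, `LEC/IwasawaLengthTransfer.lean`; normalisation A.7 proved
  modulo the Beilinson–Flach class identification (X), audit-1 addendum F) and graded PASS-in-cell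
  for the deduction by both readers; the node itself stays PRE (BSTW Part I zeta element / explicit
  reciprocity laws, statement-audited) — «re-word, not retire»;
  (N4) Thm. 3.2.1 = [Wan15, Thm. 3] (p. 7 L19–48, Hyp. 3.1.1 (H1)–(H3)) ⇐ Wan, FMS 3 (2015) e18,
  Thm. 101 ← Lemma 87 ← Thm. 86 (3), whose proof «free of rank one over `T_{m_f}` … using the
  argument of [9, Theorem 11.2]»
  [corpus:paper:wan2015-iwasawa-main-conjecture-hilbert-modular-forms p0070:L24–26]
  = K. Fujiwara, arXiv:math/0602606 Thm. 12.2 (UNPUBLISHED; no refereed publication located, corpus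
  + galaxy, 2026-08-26; opened first-hand by reader 2, add1 §A1: in the MINIMAL deformation type
  every printed hypothesis of Thms. 12.1/12.2 is met on every D1 instance, but the module is
  K-TYPED, so Wan's Γ₀-level freeness follows literally only where the types coincide) is THE GAP
  LINE, load-bearing in BOTH ranks and for the `⊗ ℚ_p` use; the gap is typed as the prose target
  FREE(E, p, F) of reader 2 §5(f) (`S^B(U₀(𝔫); O)_𝔪` free of rank one over `𝕋_𝔪` for the base change
  `g_F` to the real quadratic `F`, `p` inert, `B/F` totally definite unramified at all finite
  places) — not typable in Lean today (no totally-definite-quaternionic Hecke-module vocabulary at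
  Eichler level over `F ≠ ℚ` in `Literature`; priced road
  `pub/bsd-litref/bcs25/staging/bsd-litref-bcs25-ty/TYPING-ROAD-FREE-EpF.md` 546b3cb670a49921);
  refereed print reaching PART of it (reader 1 finding F-r1-1, c5b8643a §C.2, print anchors dbc9aa2f
  §A): Manning, Algebra & Number Theory 15 (2021) 387–434 Thm. 1.1 (`k = 0`) / 1.2 / Prop. 4.14
  (minimal-level multiplicity one ⇒ freeness, `R^{fl,min} ≅ T`) + Böckle–Khare–Manning, JIMJ 2024
  Thms. 6.4/6.5 + H. Wang, Ann. Math. Québec 47 (2023) §9 / Thm. 9.1 + Diamond 1997, which together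
  reach the sub-population `Literature.NumberTheory.EllipticCurves.HWang2023.Clean W p` (`= DT ∧
  PO`, files `HWang2023/BaseChangeFreenessHypotheses{,Proofs}.lean`; `DT` = W. Zhang 2014 Thm. 1.4
  (2) = `p ∉ Z*(E)`, `HWang2023.dt_iff_zhang_thm14_hyp2` / `HWang2023.dt_iff_not_inZstar`; `PO`
  identically false at `p = 5`, `HWang2023.not_po_five`) modulo glue (G1) newvector-stabiliser lemma
  / (G2) level dictionary (reader 1; the subgroup lemma (L2) behind (G1) is the tree theorem
  `Summit.BirchSwinnertonDyer.Rank1Residual.BCS25.exists_eq_gammaZeroGL_span_pow`) and the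
  per-instance arithmetic condition (G3) = AMIN («`U₀(𝔫₀)` is deformation-minimal at the additive
  primes»; reader 2 add1 §A2, a reading of Manning's §2.2 Remark offered for grading; r1/r2
  disagreement-in-detail REPORTED, not averaged).
  On the 777 residual (class, p) instances after ROUND 336, reader 2's split (add1 §A2(b), census
  `staging/bsd-litref-bcs25-r2/amin_census.tsv` 7de26332f5c1d728): R-A DT-fail 328 (the Γ₀-module at
  a Steinberg level with `q_v ≡ 1 (mod p)`: UNSTATED in print and preprint; target (T-2b-St)) / R-B
  PO-fail 291 ([Fuj06] nearly-ordinary case, typed, unpublished; target (T-2b-n.o.), incl. every `p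
  = 5` row; Hida, *Hilbert Modular Forms and Iwasawa Theory* Ch. 3 = acq-11243, wanted) / R-C CLEAN
  ∧ AMIN-fail 19 (UNSTATED; target (T-2b-Γ₀)) / R-D CLEAN ∧ AMIN-ok 139 (the refereed chain above,
  PASS-in-print modulo (G1)(G2)(G3); 8 + 80 flag-only (`r = 0` / `r = 1`) + 47 mixed classes
  every-instance) / R-U 0 — AMIN DECIDED on every instance by the prover seat's two-engine column
  (`staging/bsd-litref-bcs25-pv/amin/amin_e1.tsv` 340fd383ed3576fb, PARI, kit j262112 ≡
  `amin_e2.tsv` 8ced4b2f67de2e5f; fold reader 2 add3 §C0, additive-type buckets reader 1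
  ADDENDUM-4);
  the former proof-level caveat `Wang23-Thm9.1-minimal@Tay06-reading` (R274.2 leg (i)) is thereby
  met in print on the R-D rows per both readers — desk C4 ROUND C4-R4: «F-r1-1 ADMITTED as the
  (2a)/(2b) cover on R-D rows»; glue «(G1) DISCHARGED» (kernel p478368 + printed (P1) Gelbart 1975
  Thm. 4.24 / (P2) Carayol / (P3) Livné), «(G2) DISCHARGED» (Manning Thm. 1.2), «(d) DISCHARGED»
  (kernel K8 + the Cornell–Silverman–Stevens printed template); «(G3)/AMIN SUSTAINED AS A GATING
  HYPOTHESIS» (maximality ≠ uniqueness at A1-bad primes; explicitly NOT a finding that freeness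
  fails on R-C rows) ⇒ «candidate list of record 88 flag-only (8 r0 + 80 r1) + 47 mixed», the 102/52
  all-CLEAN list carried as the if-(G3)-dissolved bound; R-A graded «UNSTATED, not merely
  unpublished»;
  second [Fuj06] entry point inside [Wan15, Prop. 96] (p. 79 L42–p. 80 L7: Gorensteinness of the CM
  local ring of `g_θ` and the congruence divisibility, attributed to Hida, Doc. Math. 2006 — printed
  under the split-conductor condition (S) = [HMI] §3.2.1 (h2), which Wan's bullet 5 violates — and
  Hida, IMRN 2009 — removes (S) for the main conjecture only and imports Fujiwara; Hida 2025 [Hi4]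
  p. 46: the `I(ψ)R(ψ) ≠ 1` case «is not treated in [HMI]») = reader 1 finding F-r1-2 (dbc9aa2f §E;
  prose target GOR(θ; M/F, p)), reader 2 CONCUR with self-correction of fac923bf §5(c)
  «book-printed» (fca86de9; verbatim [Hida06] loci fc58c16b): a CLASS-INDEPENDENT node
  `Wan15-Prop96-Gorenstein(g_θ)@Hida06(S)/Hida09-reading` over `@Fuj06-n.o.-CM(sc-prime)` — F-r1-1
  retires the (2a)/(2b) legs on R-D rows only and NO D1 class is [Fuj06]-free at proof level today;
  Hida 2006 Thm. 6.1 is a refereed freeness statement at Neben-type levels only (no Steinberg form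
  in its module `V(R)`), whereas for [HMI] Cor. 3.42 both readers WITHDRAW «excludes Steinberg
  primes» (reader 1 ADDENDUM-3, reader 2 add3, after bsd-ssimc audit-1 addendum H 080c80953763d50f):
  its (h1)–(h4) ADMIT ramified Steinberg primes in Hida's own refereed use (Pure Appl. Math. Q. 5
  (2009) p. 1376; level `Γ₀(Np)`, Publ. RIMS 45 (2009) pp. 22–23), the additive local types and
  (ds_Q)/(Q1–6) stay UNDECIDED without the book (acq-11243: four page-targeted questions; a YES
  re-words R-B rows to `@HMI-Cor3.42(book+errata)`, never a move) — reading desk C4 ROUND C4-R4: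
  «F-r1-2 ENDORSED ×2-CONCUR», token of record
  `Wan15-Prop96-Gorenstein(g_θ)@Hida06(S)/Hida09-reading(⇐Fuj06-n.o.-CM)`, «THE NODE OF RECORD THAT
  BLOCKS EVERY CANDIDATE MOVER»; [HMI]/acq-11243 consolidated question list (Q-A)–(Q-D) of record,
  census ceiling of a book-YES «0 under the narrowest printed reading»;
  (Hid04) [Wan15, Prop. 96] ⇐ [Hsi12, Thm. A] ⇐ [Hid04, Thm. 3.2/3.3] (gap pointed out by Venkatesh;
  repair [Hi4] «to appear» in the WS volume doi:10.1142/14969, unrefereed, 0 chapter DOIs on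
  2026-08-26; Ohta, J. Math. Soc. Japan 2026 is `F = ℚ` only) — CONFIRMED informational by both
  readers; the existence/Zariski-dense strength is what D1 uses (desk C4 ROUND C4-R4 (δ): «CONFIRMED
  ×2 — VERDICT OF RECORD with the refined grade» — Zariski-dense strength only, repaired-unrefereed
  by [Hi4] with reader 1's transposition rider, cofinite clause unused on D1); N6 (`μ = 0`,
  [Hsi14, Thm. B]) is not an entry point of this gap (reader 2 add1 §A3).
* CENSUS ROADS that bypass this fact on D1 cells (no change to this file; bookings are referee A's):
  **T-ZH14** = W. Zhang, Camb. J. Math. 2 (2014) Thm. 1.6 BY NAME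
  (`WZhang2014_padicValRat_bsd_rank_one_ordinary`, glue `Rank1Residual.bsdp_rankOne_of_WZhang2014`,
  row-C2 doors `Summit.BirchSwinnertonDyer.Rank1Residual.RowC2.bsdp_rankOne_of_zhang` /
  `…_of_two_ram`, preprint-free) — BOOKED by referee A ROUND 336 (2026-08-26) PROVED-by-name on the
  `r_an = 1 ∧ zhang(p)` cells (6 069 flag-only D1 classes; second reading
  `ZH14-SECOND-READING-ty-v1.md` 5b26cb818baeb7ea adopted as the lane's row text; markers `zh14:X0N`
  / `zh14:shimura`); and the per-pair Heegner-index certificate road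
  `Summit.BirchSwinnertonDyer.Rank1Residual.Supersingular.bsdp_of_jetchevTamagawaCertificate`
  (Jetchev 2008 Cor. 1.5, whose Hypothesis (∗) `p ∤ N ∧ ρ̄` surjective is automatic on D1; T1
  stratum D1-IDX). Residual D1 object after ROUND 336: 533 flag-only + 239 mixed classes (777
  (class, p) instances) on which this composite is the only printed cover.
* TREE CROSS-REFERENCE (no new dependence): the tree's two transcriptions of Thm. 1.1.2 (b) of the
  same paper — `burungale_castella_skinner_charIdeal_eq_padicLFunction_integral`
  (`CyclotomicIwasawaMainTheoremIrreducible.lean`) and `BurungaleCastellaSkinner2025.thm112b_…`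
  (`CyclotomicMainTheoremIntegral.lean`) — are kernel-bridged both ways in
  `BurungaleCastellaSkinner2025/CyclotomicMainTheoremIntegralProofs.lean` modulo the period fact
  `realPeriodRat_eq_unit_mul_plusPeriod`; neither is this corollary.
-/

noncomputable section

open scoped Classical

open WeierstrassCurve Literature.NumberTheory.EllipticCurves
  Literature.NumberTheory.EllipticCurves.Rank1Residual

namespace Literature.NumberTheory.EllipticCurves.BurungaleCastellaSkinner2025

/-- **Burungale–Castella–Skinner, IMRN 2025 (rnaf082) = arXiv:2405.00270v2, Cor. 1.3.1 (p. 4)**: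
"Let `E/ℚ` be a non-CM elliptic curve. Let `p > 3` be a prime of good ordinary reduction such that
(irr_ℚ) and (im) hold. If `ord_{s=1} L(E,s) = r ∈ {0,1}`, then
`|L^{(r)}(E,1)/(Reg(E)·Ω_E)|_p^{-1} = |#Ш(E)·∏_{ℓ∤∞} c_ℓ(E)|_p^{-1}` and hence the `p`-part of the
[…] BSD formula for `E` is true" (one adjective elided), with (irr_ℚ) = "`E[p]` is an irreducible `G_ℚ`-module"
and (im) = "there exists `σ ∈ G_{ℚ(μ_{p^∞})}` such that `T/(σ − 1)T ≃ ℤ_p`" (p. 2); "the above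
result does not impose any condition on the conductor of `E`" (Rem. 1.3.2). Hypotheses in the
cell's predicate names (module docstring): `¬ W.HasCM`, `3 < p`, `GoodOrd W p`, `Irr W p`,
`BigIm W p`, `W.analyticRank ≤ 1`, `Finite W.sha` (kept as a binder, as in bsd.S30); conclusion:
`L^{(r)}(E,1)/(Reg·Ω_E)` is a rational `q` with `ord_p q = ord_p #Ш + ord_p ∏ c_ℓ`. PUBLISHED
(census row T-BCS, class C2). [cite: BurungaleCastellaSkinner2025, Cor. 1.3.1 (p. 4 of arXiv:2405.00270v2) and (irr_Q), (im) (p. 2)] -/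
def cor131_padicValRat_bsd_rank_le_one : Prop :=
  ∀ (W : WeierstrassCurve ℚ) [W.IsElliptic] [W.IsGloballyMinimal] (p : ℕ) [Fact p.Prime],
    ¬ W.HasCM → 3 < p → GoodOrd W p → Irr W p → BigIm W p →
    W.analyticRank ≤ 1 → Finite W.sha →
    ∃ q : ℚ, W.leadingLCoeff / ((W.realPeriodRat * W.regulator : ℝ) : ℂ) = (q : ℂ) ∧
      padicValRat p q = (padicValNat p W.shaOrder : ℤ) + padicValNat p W.tamagawaProduct

/-- **Cor. 1.3.1 ⇒ Miller's `BSD(E,p)`** for every `(E,p)` in its scope: a non-CM `E/ℚ` with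
`ord_{s=1} L(E,s) ≤ 1` and a good ordinary `p > 3` with (irr_ℚ) and (im). The finiteness binder is
supplied by Gross–Zagier–Kolyvagin (`hGZK` = bsd.S17, "`r_an ≤ 1 ⇒ Ш finite`"), and the print shape
is turned into `BSDp W p` by the cell's bridge `bsdp_of_padicVal_printShape` (irreducible `E[p]`
kills the torsion term). This is census row T-BCS / class C2 of RESIDUAL-CASES §a.1 as a tree
implication. [cite: BurungaleCastellaSkinner2025, Cor. 1.3.1 (p. 4)] [cite: Miller2011LMS, Def. 1.1] -/
theorem bsdp_of_cor131 (h : cor131_padicValRat_bsd_rank_le_one)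
    (hGZK : rank_eq_analyticRank_of_analyticRank_le_one)
    (W : WeierstrassCurve ℚ) [W.IsElliptic] [W.IsGloballyMinimal] (p : ℕ) [Fact p.Prime]
    (hcm : ¬ W.HasCM) (hp : 3 < p) (hord : GoodOrd W p) (hirr : Irr W p) (him : BigIm W p)
    (hr : W.analyticRank ≤ 1) : BSDp W p :=
  bsdp_of_padicVal_printShape W p hGZK hr hirr (h W p hcm hp hord hirr him hr (hGZK W hr).2)

end Literature.NumberTheory.EllipticCurves.BurungaleCastellaSkinner2025
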